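import Summits.QuantumFields.BalabanUV.T4Continuum.Support.SmallFieldDomainsNorms
import Literature.MathematicalPhysics.QuantumFieldTheory.Balaban1983to89.B7Prop1Explicit

/-!
# T⁴ programme, SUBSTRATE — `Support/SmallFieldDomainsMetric`: the MULTISCALE LATTICE-PATH METRIC on `ℤ^d` — weighted unit-step paths,
# `msDist w x y = inf` of path costs, symmetry, TRIANGLE INEQUALITY, comparison with the `ℓ¹` distance — and the [Balaban1984PropagatorsII]
# (2.46)-type weight read from a domain sequence (a fine bond in the layer of index `j` costs `(s j)⁻¹`)

Audit cell `pub-balaban`, SUBSTRATE cell seat p4 (focus «multiscale norms»); companion of `Support/SmallFieldDomains` (`ptIndex`, `layer`) and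
`…Norms` (`constSeq`), same namespace; `ℓ¹` length `l1` and unit vectors `e μ` from `B7Prop1Explicit` BY NAME.
WHAT IS PRINTED (documentation; read AS AN IMAGE on the render `b2b-balaban-ref1/pages/1984-cmp96-propagators-rt-II/…-p009-x2.png`, T. Bałaban,
*Propagators and renormalization transformations for lattice gauge theories. II*, Commun. Math. Phys. **96** (1984) 223–250, p. 231):
*"For an arbitrary contour Γ on the lattice T_η we put |Γ| = nη, where n is a number of bonds the contour Γ consists of. … We consider a
special class of contours Γ. They have the property that a part of Γ contained in B^j(Λ_j) consists of bonds of the lattice Λ_j. Now we define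
d(y, y′) = inf_{Γ_{y,y′}} Σ_{j=0}^{k} (L^jη)^{−1}|Γ_{y,y′} ∩ B^j(Λ_j)|, y, y′ ∈ 𝔅, (2.46) where the infimum is taken over all admissible contours
described above, with endpoints y, y′."*; [Balaban1985BackgroundPropagators] p. 397 (render p009): *"the weighted distance d(y, y′) defined by
(2.36) [sic] in [4]"* — the `dist` of the decay factors `e^{−δ₀d(y,y′)}` of Thm 3.1 (the tree's abstract field `B9.Geometry.dist`).
READING (declared; DIVERGENCE row owed by the typer): unit-step paths through ALL fine points (the printed admissibility «bonds of Λ_j inside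
B^j(Λ_j)» is DROPPED — this can only decrease the infimum); a fine bond is charged the SYMMETRIC weight `layerWeight s k Ω a b =
((s (ι a))⁻¹ + (s (ι b))⁻¹)/2`, `ι = ptIndex k Ω`, `s j` the scale of level `j` (`L^jη`): inside layer `j` a fine bond costs `(s j)⁻¹`.
WHAT THIS FILE PROVIDES (all `[folklore]`): §1 unit-step paths on `ℤ^d` (`Adj`, `IsPath`, `pathEnd`, `pathCost`), concatenation, reversal,
a staircase of length `l1 (y − x)` (`exists_path_length`), `l1_le_length`; §2 `msDist w x y := sInf {costs}`: `msDist_le_pathCost`, `_nonneg`,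
`_self`, **`msDist_comm`**, **`msDist_triangle`**, **`msDist_le_mul_l1`** ∕ **`mul_l1_le_msDist`** (two-sided `ℓ¹` comparison), `msDist_const`;
§3 `layerWeight`, **`msDistΩ`** with the inherited properties and the GLOBAL case **`msDistΩ_constSeq`** (`d = (s k)⁻¹·ℓ¹` exactly).
HONEST FRAMING (T4-DAG p. 1).  Metric bookkeeping on `ℤ^d`; no configuration, no estimate; the printed decay theorems are NOT touched.  NOT an
estimate of any NE row; spine 0/9 unchanged; NOT infinite volume, NOT a mass gap, NOT Clay.  HONEST DEPENDENCY: continuum YM on T⁴ ⇐ BetaPertH ∧ nine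
spine estimates (0/9 proved); BetaPertH ⇐ (D1) ∧ (D4) ∧ CAP+tail; G-an2-4 gates asym, D1 and NE2/3/4.  No `sorry`.
-/

noncomputable section

open scoped BigOperators

namespace Summit.QuantumFields.BalabanUV.T4Continuum.SmallFieldDomains

open Literature.MathematicalPhysics.QuantumFieldTheory.Balaban1983to89.B14DomainGeom
open Literature.MathematicalPhysics.QuantumFieldTheory.Balaban1983to89.B7Prop1Explicit (l1 e l1_neg l1_zsmul_e l1_add_le)

variable {d : ℕ}

/-! ## §1 Unit-step paths on `ℤ^d` -/

/-- Unit-step adjacency: `y = x + e_μ` or `y = x − e_μ` for some direction `μ`. [folklore] -/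
def Adj (x y : Pt d) : Prop := ∃ μ : Fin d, y = x + e μ ∨ y = x - e μ

/-- Adjacency is symmetric. [folklore] -/
theorem Adj.symm {x y : Pt d} (h : Adj x y) : Adj y x := by
  obtain ⟨μ, h | h⟩ := h
  · exact ⟨μ, Or.inr (by rw [h, add_sub_cancel_right])⟩
  · exact ⟨μ, Or.inl (by rw [h, sub_add_cancel])⟩

/-- A PATH from `x`: the list of the successive points after `x`, each adjacent to the previous one. [folklore] -/
def IsPath : Pt d → List (Pt d) → Prop
  | _, [] => True
  | x, y :: l => Adj x y ∧ IsPath y l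

/-- The endpoint of a path. [folklore] -/
def pathEnd : Pt d → List (Pt d) → Pt d
  | x, [] => x
  | _, y :: l => pathEnd y l

/-- The COST of a path for a bond weight `w`: the sum of the weights of its bonds. [folklore] -/
def pathCost (w : Pt d → Pt d → ℝ) : Pt d → List (Pt d) → ℝ
  | _, [] => 0
  | x, y :: l => w x y + pathCost w y l

/-- The empty path is a path. [folklore] -/
@[simp] theorem isPath_nil (x : Pt d) : IsPath x [] := trivial
/-- A path with a first step, unfolded. [folklore] -/
@[simp] theorem isPath_cons (x y : Pt d) (l : List (Pt d)) : IsPath x (y :: l) ↔ Adj x y ∧ IsPath y l := Iff.rfl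
/-- The endpoint of the empty path. [folklore] -/
@[simp] theorem pathEnd_nil (x : Pt d) : pathEnd x [] = x := rfl
/-- The endpoint after a first step. [folklore] -/
@[simp] theorem pathEnd_cons (x y : Pt d) (l : List (Pt d)) : pathEnd x (y :: l) = pathEnd y l := rfl
/-- The empty path costs nothing. [folklore] -/
@[simp] theorem pathCost_nil (w : Pt d → Pt d → ℝ) (x : Pt d) : pathCost w x [] = 0 := rfl
/-- The cost after a first step. [folklore] -/
@[simp] theorem pathCost_cons (w : Pt d → Pt d → ℝ) (x y : Pt d) (l : List (Pt d)) :
    pathCost w x (y :: l) = w x y + pathCost w y l := rfl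

/-- Costs are non-negative for a non-negative weight. [folklore] -/
theorem pathCost_nonneg {w : Pt d → Pt d → ℝ} (hw : ∀ a b, 0 ≤ w a b) : ∀ (x : Pt d) (l : List (Pt d)), 0 ≤ pathCost w x l
  | _, [] => le_rfl
  | x, y :: l => add_nonneg (hw x y) (pathCost_nonneg hw y l)

/-- Costs are at most `C` per bond. [folklore] -/
theorem pathCost_le_mul_length {w : Pt d → Pt d → ℝ} {C : ℝ} (hw : ∀ a b, w a b ≤ C) :
    ∀ (x : Pt d) (l : List (Pt d)), pathCost w x l ≤ C * l.length
  | _, [] => by simp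
  | x, y :: l => by
    rw [pathCost_cons, List.length_cons, Nat.cast_succ, mul_add, mul_one, add_comm (C * _)]
    exact add_le_add (hw x y) (pathCost_le_mul_length hw y l)

/-- CONCATENATION of paths: path, endpoint and cost. [folklore] -/
theorem path_append {w : Pt d → Pt d → ℝ} : ∀ (x : Pt d) (l₁ l₂ : List (Pt d)), IsPath x l₁ → IsPath (pathEnd x l₁) l₂ →
    IsPath x (l₁ ++ l₂) ∧ pathEnd x (l₁ ++ l₂) = pathEnd (pathEnd x l₁) l₂ ∧
      pathCost w x (l₁ ++ l₂) = pathCost w x l₁ + pathCost w (pathEnd x l₁) l₂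
  | x, [], l₂, _, h₂ => by simpa using h₂
  | x, y :: l₁, l₂, h₁, h₂ => by
    obtain ⟨hxy, h₁'⟩ := h₁
    obtain ⟨hp, he, hc⟩ := path_append y l₁ l₂ h₁' h₂
    refine ⟨⟨hxy, hp⟩, he, ?_⟩
    rw [List.cons_append, pathCost_cons, hc, pathCost_cons, add_assoc]
    rfl

/-- Appending ONE adjacent point at the end. [folklore] -/
theorem path_append_single {w : Pt d → Pt d → ℝ} (x : Pt d) (l : List (Pt d)) (z : Pt d) (h : IsPath x l)
    (hz : Adj (pathEnd x l) z) :
    IsPath x (l ++ [z]) ∧ pathEnd x (l ++ [z]) = z ∧ pathCost w x (l ++ [z]) = pathCost w x l + w (pathEnd x l) z := by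
  obtain ⟨hp, he, hc⟩ := path_append (w := w) x l [z] h ⟨hz, trivial⟩
  exact ⟨hp, he, by rw [hc, pathCost_cons, pathCost_nil, add_zero]⟩

/-- REVERSAL: a path from `x` to `y` yields a path from `y` to `x` with the same cost (symmetric weight). [folklore] -/
theorem exists_reverse_path {w : Pt d → Pt d → ℝ} (hws : ∀ a b, w a b = w b a) :
    ∀ (x : Pt d) (l : List (Pt d)), IsPath x l →
      ∃ l', IsPath (pathEnd x l) l' ∧ pathEnd (pathEnd x l) l' = x ∧ pathCost w (pathEnd x l) l' = pathCost w x l ∧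
        l'.length = l.length
  | x, [], _ => ⟨[], trivial, rfl, rfl, rfl⟩
  | x, y :: l, h => by
    obtain ⟨hxy, hl⟩ := h
    obtain ⟨m, hm, hme, hmc, hlen⟩ := exists_reverse_path hws y l hl
    have hadj : Adj (pathEnd (pathEnd y l) m) x := by rw [hme]; exact hxy.symm
    obtain ⟨hp, he, hc⟩ := path_append_single (w := w) _ m x hm hadj
    refine ⟨m ++ [x], ?_, ?_, ?_, by simp [hlen]⟩
    · simpa only [pathEnd_cons] using hp
    · simpa only [pathEnd_cons] using he
    · simp only [pathEnd_cons, pathCost_cons]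
      rw [hc, hmc, hme, hws y x, add_comm]

/-- One step towards `y` lowers the `ℓ¹` distance by one. [folklore] -/
theorem exists_step_l1 {x y : Pt d} (h : x ≠ y) : ∃ x', Adj x x' ∧ l1 (y - x') + 1 = l1 (y - x) := by
  classical
  have : ∃ i, x i ≠ y i := by
    by_contra hall
    push Not at hall
    exact h (funext hall)
  obtain ⟨i, hi⟩ := this
  -- move coordinate `i` one unit towards `y i`
  rcases lt_or_gt_of_ne hi with hlt | hgt
  · refine ⟨x + e i, ⟨i, Or.inl rfl⟩, ?_⟩
    unfold l1
    rw [← Finset.add_sum_erase _ _ (Finset.mem_univ i), ← Finset.add_sum_erase _ _ (Finset.mem_univ i)]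
    have hsame : ∀ κ ∈ Finset.univ.erase i, ((y - (x + e i)) κ).natAbs = ((y - x) κ).natAbs := by
      intro κ hκ
      have hκi : κ ≠ i := (Finset.mem_erase.mp hκ).1
      simp [e, Pi.single_eq_of_ne hκi]
    rw [Finset.sum_congr rfl hsame]
    have hi' : ((y - (x + e i)) i).natAbs + 1 = ((y - x) i).natAbs := by
      simp only [Pi.sub_apply, Pi.add_apply, e, Pi.single_eq_same]
      omega
    omega
  · refine ⟨x - e i, ⟨i, Or.inr rfl⟩, ?_⟩
    unfold l1
    rw [← Finset.add_sum_erase _ _ (Finset.mem_univ i), ← Finset.add_sum_erase _ _ (Finset.mem_univ i)]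
    have hsame : ∀ κ ∈ Finset.univ.erase i, ((y - (x - e i)) κ).natAbs = ((y - x) κ).natAbs := by
      intro κ hκ
      have hκi : κ ≠ i := (Finset.mem_erase.mp hκ).1
      simp [e, Pi.single_eq_of_ne hκi]
    rw [Finset.sum_congr rfl hsame]
    have hi' : ((y - (x - e i)) i).natAbs + 1 = ((y - x) i).natAbs := by
      simp only [Pi.sub_apply, e, Pi.single_eq_same]
      omega
    omega

/-- **EXISTENCE OF A SHORTEST STAIRCASE**: between any two points there is a unit-step path of length `l1 (y − x)`. [folklore] -/
theorem exists_path_length : ∀ (n : ℕ) (x y : Pt d), l1 (y - x) = n → ∃ l, IsPath x l ∧ pathEnd x l = y ∧ l.length = n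
  | 0, x, y, h => by
    refine ⟨[], trivial, ?_, rfl⟩
    -- `l1 (y - x) = 0` forces `y = x`
    have : ∀ i, (y - x) i = 0 := by
      intro i
      have hle : ((y - x) i).natAbs ≤ l1 (y - x) :=
        Finset.single_le_sum (f := fun κ => ((y - x) κ).natAbs) (fun _ _ => Nat.zero_le _) (Finset.mem_univ i)
      rw [h] at hle
      exact Int.natAbs_eq_zero.mp (Nat.le_zero.mp hle)
    funext i
    have := this i
    rw [Pi.sub_apply, sub_eq_zero] at this
    exact this.symm
  | n + 1, x, y, h => by
    have hne : x ≠ y := by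
      rintro rfl
      simp [l1] at h
    obtain ⟨x', hadj, hx'⟩ := exists_step_l1 hne
    have hn : l1 (y - x') = n := by omega
    obtain ⟨l, hl, hle, hlen⟩ := exists_path_length n x' y hn
    exact ⟨x' :: l, ⟨hadj, hl⟩, hle, by simp [hlen]⟩

/-! ## §2 The path (pseudo)metric -/

/-- The set of costs of paths from `x` to `y`. [folklore] -/
def costSet (w : Pt d → Pt d → ℝ) (x y : Pt d) : Set ℝ := {c | ∃ l, IsPath x l ∧ pathEnd x l = y ∧ pathCost w x l = c}

/-- **THE MULTISCALE PATH DISTANCE**: the infimum of the costs of unit-step paths from `x` to `y` for the bond weight `w`. [folklore] -/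
def msDist (w : Pt d → Pt d → ℝ) (x y : Pt d) : ℝ := sInf (costSet w x y)

section Dist
variable {w : Pt d → Pt d → ℝ}

/-- The cost set is non-empty (a staircase path exists). [folklore] -/
theorem costSet_nonempty (w : Pt d → Pt d → ℝ) (x y : Pt d) : (costSet w x y).Nonempty := by
  obtain ⟨l, hl, he, -⟩ := exists_path_length (l1 (y - x)) x y rfl
  exact ⟨_, l, hl, he, rfl⟩

/-- The cost set is bounded below by `0` (non-negative weight). [folklore] -/
theorem costSet_bddBelow (hw : ∀ a b, 0 ≤ w a b) (x y : Pt d) : BddBelow (costSet w x y) :=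
  ⟨0, fun _ ⟨l, _, _, hc⟩ => hc ▸ pathCost_nonneg hw x l⟩

/-- The distance is at most the cost of any path. [folklore] -/
theorem msDist_le_pathCost (hw : ∀ a b, 0 ≤ w a b) {x y : Pt d} {l : List (Pt d)} (hl : IsPath x l) (he : pathEnd x l = y) :
    msDist w x y ≤ pathCost w x l :=
  csInf_le (costSet_bddBelow hw x y) ⟨l, hl, he, rfl⟩

/-- A lower bound valid for every path is a lower bound for the distance. [folklore] -/
theorem le_msDist {x y : Pt d} {b : ℝ} (h : ∀ l, IsPath x l → pathEnd x l = y → b ≤ pathCost w x l) : b ≤ msDist w x y :=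
  le_csInf (costSet_nonempty w x y) fun _ ⟨l, hl, he, hc⟩ => hc ▸ h l hl he

/-- `0 ≤ msDist`. [folklore] -/
theorem msDist_nonneg (hw : ∀ a b, 0 ≤ w a b) (x y : Pt d) : 0 ≤ msDist w x y :=
  le_msDist fun l _ _ => pathCost_nonneg hw x l

/-- `msDist x x = 0`. [folklore] -/
theorem msDist_self (hw : ∀ a b, 0 ≤ w a b) (x : Pt d) : msDist w x x = 0 :=
  le_antisymm (by simpa using msDist_le_pathCost hw (l := []) (x := x) trivial rfl) (msDist_nonneg hw x x)

/-- **SYMMETRY** for a symmetric weight. [folklore] -/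
theorem msDist_comm (hw : ∀ a b, 0 ≤ w a b) (hws : ∀ a b, w a b = w b a) (x y : Pt d) : msDist w x y = msDist w y x := by
  have key : ∀ x y : Pt d, msDist w y x ≤ msDist w x y := by
    intro x y
    refine le_msDist fun l hl he => ?_
    obtain ⟨l', hl', he', hc', -⟩ := exists_reverse_path hws x l hl
    rw [he] at hl' he' hc'
    calc msDist w y x ≤ pathCost w y l' := msDist_le_pathCost hw hl' he'
      _ = pathCost w x l := hc'
  exact le_antisymm (key y x) (key x y)

/-- **TRIANGLE INEQUALITY**. [folklore] -/
theorem msDist_triangle (hw : ∀ a b, 0 ≤ w a b) (x y z : Pt d) : msDist w x z ≤ msDist w x y + msDist w y z := by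
  -- for every path `x → y`, `msDist x z − cost ≤ msDist y z`; then optimise over the path
  have h1 : ∀ l₁, IsPath x l₁ → pathEnd x l₁ = y → msDist w x z - pathCost w x l₁ ≤ msDist w y z := by
    intro l₁ hl₁ he₁
    refine le_msDist fun l₂ hl₂ he₂ => ?_
    have hl₂' : IsPath (pathEnd x l₁) l₂ := by rw [he₁]; exact hl₂
    obtain ⟨hp, he, hc⟩ := path_append (w := w) x l₁ l₂ hl₁ hl₂'
    have hend : pathEnd x (l₁ ++ l₂) = z := by rw [he, he₁, he₂]
    have := msDist_le_pathCost hw hp hend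
    rw [hc, he₁] at this
    linarith
  have h2 : msDist w x z - msDist w y z ≤ msDist w x y :=
    le_msDist fun l₁ hl₁ he₁ => by have := h1 l₁ hl₁ he₁; linarith
  linarith

/-- **COMPARISON WITH `ℓ¹`**: a weight bounded by `C` gives `msDist ≤ C · ℓ¹(x, y)` (the staircase path). [folklore] -/
theorem msDist_le_mul_l1 (hw : ∀ a b, 0 ≤ w a b) {C : ℝ} (hC : ∀ a b, w a b ≤ C) (x y : Pt d) :
    msDist w x y ≤ C * (l1 (y - x) : ℝ) := by
  obtain ⟨l, hl, he, hlen⟩ := exists_path_length (l1 (y - x)) x y rfl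
  calc msDist w x y ≤ pathCost w x l := msDist_le_pathCost hw hl he
    _ ≤ C * l.length := pathCost_le_mul_length hC x l
    _ = C * (l1 (y - x) : ℝ) := by rw [hlen]


/-- An adjacent step has `ℓ¹` length one. [folklore] -/
theorem l1_of_adj {x y : Pt d} (h : Adj x y) : l1 (y - x) = 1 := by
  obtain ⟨μ, h | h⟩ := h
  · rw [h, add_sub_cancel_left]
    simpa using l1_zsmul_e (d := d) 1 μ
  · rw [h, sub_sub_cancel_left, l1_neg]
    simpa using l1_zsmul_e (d := d) 1 μ

/-- Every path from `x` to `y` has at least `ℓ¹(x, y)` bonds. [folklore] -/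
theorem l1_le_length : ∀ (x : Pt d) (l : List (Pt d)), IsPath x l → l1 (pathEnd x l - x) ≤ l.length
  | x, [], _ => by simp [l1]
  | x, y :: l, h => by
    obtain ⟨hxy, hl⟩ := h
    have ih := l1_le_length y l hl
    have htri : l1 (pathEnd y l - x) ≤ l1 (pathEnd y l - y) + l1 (y - x) := by
      have e1 : pathEnd y l - x = (pathEnd y l - y) + (y - x) := by abel
      rw [e1]; exact l1_add_le _ _
    rw [pathEnd_cons, List.length_cons, l1_of_adj hxy] at *
    omega

/-- Costs are at least `c` per bond when every bond weighs at least `c`. [folklore] -/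
theorem mul_length_le_pathCost {w : Pt d → Pt d → ℝ} {c : ℝ} (hw : ∀ a b, Adj a b → c ≤ w a b) :
    ∀ (x : Pt d) (l : List (Pt d)), IsPath x l → c * l.length ≤ pathCost w x l
  | _, [], _ => by simp
  | x, y :: l, h => by
    obtain ⟨hxy, hl⟩ := h
    rw [pathCost_cons, List.length_cons, Nat.cast_succ, mul_add, mul_one, add_comm (c * _)]
    exact add_le_add (hw x y hxy) (mul_length_le_pathCost hw y l hl)

/-- **LOWER COMPARISON WITH `ℓ¹`**: a weight `≥ c ≥ 0` on bonds gives `c · ℓ¹(x, y) ≤ msDist` (the direction decay bounds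
`e^{−δ₀ d}` consume). [folklore] -/
theorem mul_l1_le_msDist {c : ℝ} (hc : 0 ≤ c) (hw : ∀ a b, Adj a b → c ≤ w a b) (x y : Pt d) :
    c * (l1 (y - x) : ℝ) ≤ msDist w x y := by
  refine le_msDist fun l hl he => ?_
  have h1 : (l1 (y - x) : ℝ) ≤ l.length := by
    have := l1_le_length x l hl
    rw [he] at this
    exact_mod_cast this
  calc c * (l1 (y - x) : ℝ) ≤ c * l.length := mul_le_mul_of_nonneg_left h1 hc
    _ ≤ pathCost w x l := mul_length_le_pathCost hw x l hl

end Dist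

/-! ## §3 The (2.46)-type weight of a domain sequence and its distance -/

section Layer
variable (s : ℕ → ℝ) (k : ℕ) (Ω : ℕ → Set (Pt d))

/-- THE LAYER WEIGHT of a domain sequence: the fine bond `{a, b}` costs the average of the inverse scales at its endpoints' indices,
`((s (ι a))⁻¹ + (s (ι b))⁻¹)/2` (`= (s j)⁻¹` for a bond inside the layer `j`).  The cell's READING of the (2.46) weights (see the module
docstring). [folklore] -/
def layerWeight (a b : Pt d) : ℝ := ((s (ptIndex k Ω a))⁻¹ + (s (ptIndex k Ω b))⁻¹) / 2

/-- The layer weight is symmetric. [folklore] -/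
theorem layerWeight_comm (a b : Pt d) : layerWeight s k Ω a b = layerWeight s k Ω b a := by
  unfold layerWeight; rw [add_comm]

/-- The layer weight is non-negative for positive scales. [folklore] -/
theorem layerWeight_nonneg (hs : ∀ j, 0 < s j) (a b : Pt d) : 0 ≤ layerWeight s k Ω a b := by
  unfold layerWeight
  have h1 : 0 ≤ (s (ptIndex k Ω a))⁻¹ := inv_nonneg.mpr (hs _).le
  have h2 : 0 ≤ (s (ptIndex k Ω b))⁻¹ := inv_nonneg.mpr (hs _).le
  linarith

/-- Inside one layer the weight is the inverse scale of that layer. [folklore] -/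
theorem layerWeight_eq_of_ptIndex_eq {a b : Pt d} {j : ℕ} (ha : ptIndex k Ω a = j) (hb : ptIndex k Ω b = j) :
    layerWeight s k Ω a b = (s j)⁻¹ := by
  unfold layerWeight; rw [ha, hb]; ring

/-- A uniform bound: if every scale is at least `m > 0`, every bond costs at most `m⁻¹`. [folklore] -/
theorem layerWeight_le {m : ℝ} (hm : 0 < m) (hms : ∀ j, m ≤ s j) (a b : Pt d) :
    layerWeight s k Ω a b ≤ m⁻¹ := by
  unfold layerWeight
  have h1 : (s (ptIndex k Ω a))⁻¹ ≤ m⁻¹ := inv_anti₀ hm (hms _)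
  have h2 : (s (ptIndex k Ω b))⁻¹ ≤ m⁻¹ := inv_anti₀ hm (hms _)
  linarith

/-- **THE MULTISCALE DISTANCE OF A DOMAIN SEQUENCE** (the cell's reading of [B6] (2.46)). [folklore] -/
def msDistΩ (x y : Pt d) : ℝ := msDist (layerWeight s k Ω) x y

/-- `0 ≤ d(x, y)`. [folklore] -/
theorem msDistΩ_nonneg (hs : ∀ j, 0 < s j) (x y : Pt d) : 0 ≤ msDistΩ s k Ω x y :=
  msDist_nonneg (layerWeight_nonneg s k Ω hs) x y

/-- `d(x, y) = d(y, x)`. [folklore] -/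
theorem msDistΩ_comm (hs : ∀ j, 0 < s j) (x y : Pt d) : msDistΩ s k Ω x y = msDistΩ s k Ω y x :=
  msDist_comm (layerWeight_nonneg s k Ω hs) (layerWeight_comm s k Ω) x y

/-- `d(x, z) ≤ d(x, y) + d(y, z)` (the printed (2.54) «triangle inequality for our distance»). [folklore] -/
theorem msDistΩ_triangle (hs : ∀ j, 0 < s j) (x y z : Pt d) : msDistΩ s k Ω x z ≤ msDistΩ s k Ω x y + msDistΩ s k Ω y z :=
  msDist_triangle (layerWeight_nonneg s k Ω hs) x y z

/-- `d(x, y) ≤ m⁻¹ · ℓ¹(x, y)` when every scale is `≥ m > 0` (e.g. `m = 1` in fine units: the multiscale distance never exceeds the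
fine `ℓ¹` distance). [folklore] -/
theorem msDistΩ_le_mul_l1 (hs : ∀ j, 0 < s j) {m : ℝ} (hm : 0 < m) (hms : ∀ j, m ≤ s j) (x y : Pt d) :
    msDistΩ s k Ω x y ≤ m⁻¹ * (l1 (y - x) : ℝ) :=
  msDist_le_mul_l1 (layerWeight_nonneg s k Ω hs) (layerWeight_le s k Ω hm hms) x y


/-- A uniform LOWER bound: if every scale is at most `S`, every bond costs at least `S⁻¹`. [folklore] -/
theorem inv_le_layerWeight (hs : ∀ j, 0 < s j) {S : ℝ} (hS : ∀ j, s j ≤ S) (a b : Pt d) : S⁻¹ ≤ layerWeight s k Ω a b := by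
  unfold layerWeight
  have h1 : S⁻¹ ≤ (s (ptIndex k Ω a))⁻¹ := inv_anti₀ (hs _) (hS _)
  have h2 : S⁻¹ ≤ (s (ptIndex k Ω b))⁻¹ := inv_anti₀ (hs _) (hS _)
  linarith

/-- `S⁻¹ · ℓ¹(x, y) ≤ d(x, y)` when every scale is `≤ S` (e.g. `S = L^k` in fine units: the multiscale distance dominates
`L^{−k}` times the fine `ℓ¹` distance). [folklore] -/
theorem mul_l1_le_msDistΩ (hs : ∀ j, 0 < s j) {S : ℝ} (hS0 : 0 < S) (hS : ∀ j, s j ≤ S) (x y : Pt d) :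
    S⁻¹ * (l1 (y - x) : ℝ) ≤ msDistΩ s k Ω x y :=
  mul_l1_le_msDist (inv_nonneg.mpr hS0.le) (fun a b _ => inv_le_layerWeight s k Ω hs hS a b) x y


/-- A CONSTANT weight `c ≥ 0` gives exactly `c · ℓ¹` (upper and lower comparison coincide). [folklore] -/
theorem msDist_const {c : ℝ} (hc : 0 ≤ c) (x y : Pt d) : msDist (fun _ _ => c) x y = c * (l1 (y - x) : ℝ) :=
  le_antisymm (msDist_le_mul_l1 (fun _ _ => hc) (fun _ _ => le_rfl) x y)
    (mul_l1_le_msDist hc (fun _ _ _ => le_rfl) x y)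

/-- On the TRIVIAL (global small-field) sequence every point has index `k`, so the layer weight is the constant `(s k)⁻¹`. [folklore] -/
theorem layerWeight_constSeq (x y : Pt d) : layerWeight s k (constSeq k) x y = (s k)⁻¹ := by
  have hι : ∀ z : Pt d, ptIndex k (constSeq (d := d) k) z = k := fun z =>
    (mem_layer_iff_ptIndex (bigDomainSeq_constSeq 1 1 1 k) (x := z) (by simp [constSeq])).mp
      (by rw [layer_constSeq]; simp)
  exact layerWeight_eq_of_ptIndex_eq s k _ (hι x) (hι y)

/-- **THE GLOBAL CASE**: on the trivial sequence the multiscale distance is the uniform one, `d(x, y) = (s k)⁻¹ · ℓ¹(x, y)` (one scale —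
[B5]/[B6]'s single-lattice distance in `L^kη` units). [folklore] -/
theorem msDistΩ_constSeq (hs : ∀ j, 0 < s j) (x y : Pt d) : msDistΩ s k (constSeq k) x y = (s k)⁻¹ * (l1 (y - x) : ℝ) := by
  unfold msDistΩ
  have hw : layerWeight s k (constSeq (d := d) k) = fun _ _ => (s k)⁻¹ := by
    funext a b; exact layerWeight_constSeq s k a b
  rw [hw]
  exact msDist_const (inv_nonneg.mpr (hs k).le) x y

end Layer

end Summit.QuantumFields.BalabanUV.T4Continuum.SmallFieldDomains
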